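import Summits.MatrixMultiplication.MatrixMultiplication.Theorems.ThresholdSubsetTriples.Negative.ThinnedYoungDeath

/-!
# `ThresholdSubsetTriples` (crux stmt-MatrixMultiplication-10882): the ROBUST Young barrier — no threshold triple is
# a sub-exponential thinning of three Young cosets

Negative-side helper (line lead c2, 2026-08-17; `sorry`-free, standard axioms).  Blasiak–Church–Cohn–Grochow–Umans 2017
Thm 4.2 (tree `BCCGU2017_thm42_holds`; crux form `Negative.not_thresholdYoungTriples`) kills triples of Young SUBGROUPS.
This file kills every triple that is merely CLOSE to Young: `S_i ⊆ Y_i·a_i` (`Y_i` Young subgroups, right cosets),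
`TPP(S₁, S₂, S₃)`, and `|Y_i| ≤ e^{n/(400 log n)}·|S_i|` for `i = 1, 2, 3` force
`|S₁||S₂||S₃| ≤ (n!)^{3/2}·e^{-c√n}` for `n ≥ n₀(c)` (`thinnedYoungTriple_volume_le`); hence the design family
"threshold triples thinned out of Young cosets" is empty (`not_thresholdThinnedYoungTriples`).  No symmetry is assumed;
the ℤ/3-symmetric case is `Negative/ThinnedYoungDeath.lean`.

Proof.  `pair_packing_two_cosets` (any group): `S ⊆ Y₁a`, `T ⊆ Y₂b` with the two-set consequence of the TPP ⇒
`|S||T|·|Y₁ ∩ Y₂| ≤ |Y₁||Y₂|` (the map `(s, t, z) ↦ (a s⁻¹ z, z⁻¹ t b⁻¹) ∈ Y₁ × Y₂` is injective because the product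
of its coordinates is `a (s⁻¹t) b⁻¹` and `(s, t) ↦ s⁻¹t` is injective) — so the three pairwise meets have order
`≤ θ_iθ_j ≤ e^{2t}`, `t = n/(400 log n)`; then the abstract core of `ThinnedYoungDeath` in three-order form
(`sum_log_card_le_of_meets`: delete the `≤ 12t/log 2` big-cell points, run the tree's BCCGU analytic core
`young_sum_log_le_of_costs` on the rest, transfer the costs back) gives `Σ log|Y_i| ≤ (3/2) n log n − 1.71 n ≤
(3/2) log n! − 0.21 n`, and `|S₁||S₂||S₃| ≤ |Y₁||Y₂||Y₃|`.

References: BCCGU 2017 (arXiv:1712.02302) §4 Thm 4.2; lead census `Census-c5-EnvelopeForSymmetricHosts.md` §2.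
-/

set_option linter.dupNamespace false

noncomputable section

open Finset Real

namespace Summit.MatrixMultiplication.MatrixMultiplication.Theorems.ThresholdSubsetTriples.Negative

open Literature.Combinatorics.Additive
open Literature.Barriers.MatrixMultiplication

variable {n : ℕ}

/-! ### Pair packing for two thinned cosets -/

section PairPacking

variable {G : Type*} [Group G] [DecidableEq G]

omit [DecidableEq G] in
/-- The two-set condition `s s'⁻¹ (t t'⁻¹) = 1 ⇒ s = s' ∧ t = t'` makes `(s, t) ↦ s⁻¹ t` injective. -/
theorem inv_mul_injective_of_pair {S T : Finset G}
    (hpair : ∀ s ∈ S, ∀ s' ∈ S, ∀ t ∈ T, ∀ t' ∈ T, s * s'⁻¹ * (t * t'⁻¹) = 1 → s = s' ∧ t = t')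
    {s t s₂ t₂ : G} (hs : s ∈ S) (ht : t ∈ T) (hs₂ : s₂ ∈ S) (ht₂ : t₂ ∈ T)
    (h : s⁻¹ * t = s₂⁻¹ * t₂) : s = s₂ ∧ t = t₂ := by
  have key := hpair s₂ hs₂ s hs t ht t₂ ht₂ (by
    calc s₂ * s⁻¹ * (t * t₂⁻¹) = s₂ * (s⁻¹ * t) * t₂⁻¹ := by group
      _ = s₂ * (s₂⁻¹ * t₂) * t₂⁻¹ := by rw [h]
      _ = 1 := by group)
  exact ⟨key.1.symm, key.2⟩

omit [DecidableEq G] in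
/-- **Pair packing for two thinned cosets** (any group): `S ⊆ Y₁·a`, `T ⊆ Y₂·b` and the two-set condition give
`|S|·|T|·|Y₁ ∩ Y₂| ≤ |Y₁|·|Y₂|` — the map `(s, t, z) ↦ (a s⁻¹ z, z⁻¹ t b⁻¹)` is injective into `Y₁ × Y₂`. -/
theorem pair_packing_two_cosets [Fintype G] (Y₁ Y₂ : Subgroup G) [DecidablePred (· ∈ Y₁)]
    [DecidablePred (· ∈ Y₂)] (a b : G) (S T : Finset G)
    (hS : ∀ s ∈ S, s * a⁻¹ ∈ Y₁) (hT : ∀ t ∈ T, t * b⁻¹ ∈ Y₂)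
    (hpair : ∀ s ∈ S, ∀ s' ∈ S, ∀ t ∈ T, ∀ t' ∈ T, s * s'⁻¹ * (t * t'⁻¹) = 1 → s = s' ∧ t = t') :
    S.card * T.card * (Finset.univ.filter fun z : G => z ∈ Y₁ ∧ z ∈ Y₂).card ≤
      (Finset.univ.filter fun y : G => y ∈ Y₁).card * (Finset.univ.filter fun y : G => y ∈ Y₂).card := by
  classical
  set M : Finset G := Finset.univ.filter fun z : G => z ∈ Y₁ ∧ z ∈ Y₂ with hM
  set F₁ : Finset G := Finset.univ.filter fun y : G => y ∈ Y₁ with hF₁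
  set F₂ : Finset G := Finset.univ.filter fun y : G => y ∈ Y₂ with hF₂
  let Φ : G × G × G → G × G := fun p => (a * p.1⁻¹ * p.2.2, p.2.2⁻¹ * (p.2.1 * b⁻¹))
  have hmaps : ∀ p ∈ S ×ˢ (T ×ˢ M), Φ p ∈ F₁ ×ˢ F₂ := by
    rintro ⟨s, t, z⟩ hp
    simp only [Finset.mem_product] at hp
    obtain ⟨hs, ht, hz⟩ := hp
    rw [hM, Finset.mem_filter] at hz
    obtain ⟨-, hz₁, hz₂⟩ := hz
    simp only [Finset.mem_product, hF₁, hF₂, Finset.mem_filter, Finset.mem_univ, true_and, Φ]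
    constructor
    · have h1 : a * s⁻¹ = (s * a⁻¹)⁻¹ := by group
      rw [h1]
      exact Y₁.mul_mem (Y₁.inv_mem (hS s hs)) hz₁
    · exact Y₂.mul_mem (Y₂.inv_mem hz₂) (hT t ht)
  have hinj : Set.InjOn Φ (S ×ˢ (T ×ˢ M) : Finset (G × G × G)) := by
    rintro ⟨s, t, z⟩ hp ⟨s₂, t₂, z₂⟩ hp₂ heq
    simp only [Finset.coe_product, Set.mem_prod, Finset.mem_coe] at hp hp₂
    simp only [Φ, Prod.mk.injEq] at heq
    obtain ⟨h1, h2⟩ := heq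
    have hprod : s⁻¹ * t = s₂⁻¹ * t₂ := by
      have e1 : a * s⁻¹ * z * (z⁻¹ * (t * b⁻¹)) = a * (s⁻¹ * t) * b⁻¹ := by group
      have e2 : a * s₂⁻¹ * z₂ * (z₂⁻¹ * (t₂ * b⁻¹)) = a * (s₂⁻¹ * t₂) * b⁻¹ := by group
      have e3 : a * (s⁻¹ * t) * b⁻¹ = a * (s₂⁻¹ * t₂) * b⁻¹ := by rw [← e1, ← e2, h1, h2]
      have e4 := congrArg (fun x => a⁻¹ * x * b) e3
      simpa [mul_assoc] using e4
    obtain ⟨rfl, rfl⟩ := inv_mul_injective_of_pair hpair hp.1 hp.2.1 hp₂.1 hp₂.2.1 hprod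
    have hz : z = z₂ := mul_left_cancel h1
    subst hz
    rfl
  have key := Finset.card_le_card_of_injOn Φ hmaps hinj
  simpa [Finset.card_product, mul_assoc] using key

end PairPacking

/-- Pair packing in Young form: `|S||T|·|Y_{f₁} ∩ Y_{f₂}| ≤ |Y_{f₁}||Y_{f₂}|`. -/
theorem mul_mul_meet_le (f₁ f₂ : Fin n → ℕ) (a b : Equiv.Perm (Fin n)) (S T : Finset (Equiv.Perm (Fin n)))
    (hS : ∀ s ∈ S, s * a⁻¹ ∈ youngSubgroup f₁) (hT : ∀ t ∈ T, t * b⁻¹ ∈ youngSubgroup f₂)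
    (hpair : ∀ s ∈ S, ∀ s' ∈ S, ∀ t ∈ T, ∀ t' ∈ T, s * s'⁻¹ * (t * t'⁻¹) = 1 → s = s' ∧ t = t') :
    S.card * T.card * Nat.card (youngSubgroup (fun x => (f₁ x, f₂ x))) ≤
      Nat.card (youngSubgroup f₁) * Nat.card (youngSubgroup f₂) := by
  have h := pair_packing_two_cosets (youngSubgroup f₁) (youngSubgroup f₂) a b S T hS hT hpair
  have hmeet : (univ.filter fun z : Equiv.Perm (Fin n) => z ∈ youngSubgroup f₁ ∧ z ∈ youngSubgroup f₂).card =
      Nat.card (youngSubgroup (fun x => (f₁ x, f₂ x))) := by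
    rw [← card_filter_mem_eq]
    congr 1
    ext z
    simp only [mem_filter, mem_univ, true_and, youngSubgroup_pair_eq_inf, Subgroup.mem_inf]
  rw [hmeet, card_filter_mem_eq, card_filter_mem_eq] at h
  exact h

/-! ### The abstract core in three-order form -/

/-- **Abstract core, three orders**: three labellings of `[n]` whose three pairwise meets have Young subgroups of
order `≤ e^{2t}`, `t = n/(400 log n)`, satisfy `Σ log|Y_i| ≤ (3/2) n log n − 1.71 n` (for `n ≥ 2e^{14}`). -/
theorem sum_log_card_le_of_meets (hn1 : 2 * Real.exp 14 ≤ (n : ℝ)) (f₁ f₂ f₃ : Fin n → ℕ)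
    (h12 : Real.log (Nat.card (youngSubgroup (fun x => (f₁ x, f₂ x)))) ≤ 2 * ((n : ℝ) / (400 * Real.log n)))
    (h13 : Real.log (Nat.card (youngSubgroup (fun x => (f₁ x, f₃ x)))) ≤ 2 * ((n : ℝ) / (400 * Real.log n)))
    (h23 : Real.log (Nat.card (youngSubgroup (fun x => (f₂ x, f₃ x)))) ≤ 2 * ((n : ℝ) / (400 * Real.log n))) :
    Real.log (Nat.card (youngSubgroup f₁)) + Real.log (Nat.card (youngSubgroup f₂)) +
        Real.log (Nat.card (youngSubgroup f₃)) ≤ 3 / 2 * n * Real.log n - 171 / 100 * n := by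
  classical
  have he14 : 0 < Real.exp 14 := Real.exp_pos 14
  have hnpos : (0 : ℝ) < n := by linarith
  have hlog_half : 14 ≤ Real.log ((n : ℝ) / 2) := by
    rw [Real.le_log_iff_exp_le (by linarith)]
    linarith
  have hlogn : 14 ≤ Real.log n :=
    hlog_half.trans (Real.log_le_log (by linarith) (by linarith))
  have hlogn_pos : 0 < Real.log n := by linarith
  set t : ℝ := (n : ℝ) / (400 * Real.log n) with ht_def
  have ht0 : 0 ≤ t := by positivity
  -- big points are few: each pair contributes at most `4t / log 2`
  have hlog2 : 0.6931471803 < Real.log 2 := Real.log_two_gt_d9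
  have hD12 : ((univ.filter fun x => 2 ≤ (univ.filter fun y => (f₁ y, f₂ y) = (f₁ x, f₂ x)).card).card : ℝ) * Real.log 2 ≤ 4 * t := by
    have := card_bigPts_mul_log_two_le f₁ f₂
    linarith
  have hD13 : ((univ.filter fun x => 2 ≤ (univ.filter fun y => (f₁ y, f₃ y) = (f₁ x, f₃ x)).card).card : ℝ) * Real.log 2 ≤ 4 * t := by
    have := card_bigPts_mul_log_two_le f₁ f₃
    linarith
  have hD23 : ((univ.filter fun x => 2 ≤ (univ.filter fun y => (f₂ y, f₃ y) = (f₂ x, f₃ x)).card).card : ℝ) * Real.log 2 ≤ 4 * t := by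
    have := card_bigPts_mul_log_two_le f₂ f₃
    linarith
  -- the deleted set `D` and the kept set `P`
  set D : Finset (Fin n) := (univ.filter fun x => 2 ≤ (univ.filter fun y => (f₁ y, f₂ y) = (f₁ x, f₂ x)).card) ∪ (univ.filter fun x => 2 ≤ (univ.filter fun y => (f₁ y, f₃ y) = (f₁ x, f₃ x)).card) ∪ (univ.filter fun x => 2 ≤ (univ.filter fun y => (f₂ y, f₃ y) = (f₂ x, f₃ x)).card) with hD_def
  have hDcard : (D.card : ℝ) * Real.log 2 ≤ 12 * t := by
    have h1 : D.card ≤ (univ.filter fun x => 2 ≤ (univ.filter fun y => (f₁ y, f₂ y) = (f₁ x, f₂ x)).card).card + (univ.filter fun x => 2 ≤ (univ.filter fun y => (f₁ y, f₃ y) = (f₁ x, f₃ x)).card).card + (univ.filter fun x => 2 ≤ (univ.filter fun y => (f₂ y, f₃ y) = (f₂ x, f₃ x)).card).card :=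
      (Finset.card_union_le _ _).trans (Nat.add_le_add_right (Finset.card_union_le _ _) _)
    have h1' : (D.card : ℝ) ≤ (univ.filter fun x => 2 ≤ (univ.filter fun y => (f₁ y, f₂ y) = (f₁ x, f₂ x)).card).card + (univ.filter fun x => 2 ≤ (univ.filter fun y => (f₁ y, f₃ y) = (f₁ x, f₃ x)).card).card + (univ.filter fun x => 2 ≤ (univ.filter fun y => (f₂ y, f₃ y) = (f₂ x, f₃ x)).card).card := by
      exact_mod_cast h1
    nlinarith
  set P : Finset (Fin n) := Dᶜ with hP_def
  have hPc : Pᶜ = D := by rw [hP_def, compl_compl]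
  have hcardP : (P.card : ℝ) = n - D.card := by
    have h1 : P.card = n - D.card := by
      rw [hP_def, Finset.card_compl, Fintype.card_fin]
    have h2 : D.card ≤ n := by simpa using Finset.card_le_univ D
    rw [h1, Nat.cast_sub h2]
  -- `δ := |D|` is small: `δ · 23 log n ≤ n`
  have hδ : (D.card : ℝ) * (23 * Real.log n) ≤ n := by
    have h1 : (D.card : ℝ) * Real.log 2 * (400 * Real.log n) ≤ 12 * n := by
      have := mul_le_mul_of_nonneg_right hDcard (by positivity : (0:ℝ) ≤ 400 * Real.log n)
      rwa [ht_def, show 12 * ((n : ℝ) / (400 * Real.log n)) * (400 * Real.log n) = 12 * n by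
        field_simp] at this
    nlinarith [Nat.cast_nonneg (α := ℝ) D.card]
  have hδ' : (D.card : ℝ) ≤ n / 322 := by
    have h1 : (D.card : ℝ) * (23 * 14) ≤ (D.card : ℝ) * (23 * Real.log n) := by
      apply mul_le_mul_of_nonneg_left _ (Nat.cast_nonneg _); linarith
    have : (D.card : ℝ) * 322 ≤ n := by linarith
    rw [le_div_iff₀ (by norm_num)]; linarith
  -- the kept set is large
  have hn' : (n : ℝ) / 2 ≤ P.card := by rw [hcardP]; linarith
  have hn'pos : (0 : ℝ) < (P.card : ℕ) := by
    have : (0:ℝ) < (n:ℝ) / 2 := by linarith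
    exact_mod_cast (show (0:ℝ) < P.card by linarith)
  have hn'14 : 14 ≤ Real.log (P.card : ℕ) :=
    hlog_half.trans (Real.log_le_log (by linarith) hn')
  have hlogn' : Real.log (P.card : ℕ) ≤ Real.log n :=
    Real.log_le_log hn'pos (by rw [hcardP]; linarith [Nat.cast_nonneg (α := ℝ) D.card])
  -- restricted labellings meet pairwise trivially
  have hmemP : ∀ x ∈ P, x ∉ D := fun x hx => by
    rw [hP_def, Finset.mem_compl] at hx; exact hx
  have b12 := inf_eq_bot_restrict f₁ f₂ P fun x hx hbig => hmemP x hx (by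
    rw [hD_def, Finset.mem_union, Finset.mem_union]
    exact Or.inl (Or.inl hbig))
  have b13 := inf_eq_bot_restrict f₁ f₃ P fun x hx hbig => hmemP x hx (by
    rw [hD_def, Finset.mem_union, Finset.mem_union]
    exact Or.inl (Or.inr hbig))
  have b23 := inf_eq_bot_restrict f₂ f₃ P fun x hx hbig => hmemP x hx (by
    rw [hD_def, Finset.mem_union]
    exact Or.inr hbig)
  -- the analytic core of BCCGU 2017 Thm 4.2 on the kept points
  have hcore := young_sum_log_le_of_costs (n := P.card) hn'pos hn'14
    (fun x' => (univ.filter fun y : Fin P.card => f₁ ((P.equivFin.symm y : P) : Fin n) = f₁ ((P.equivFin.symm x' : P) : Fin n)).card) (fun x' => (univ.filter fun y : Fin P.card => f₂ ((P.equivFin.symm y : P) : Fin n) = f₂ ((P.equivFin.symm x' : P) : Fin n)).card) (fun x' => (univ.filter fun y : Fin P.card => f₃ ((P.equivFin.symm y : P) : Fin n) = f₃ ((P.equivFin.symm x' : P) : Fin n)).card)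
    (one_le_card_block _) (one_le_card_block _) (one_le_card_block _)
    (sum_card_block_mul_le_real b12) (sum_card_block_mul_le_real b23) (sum_card_block_mul_le_real b13)
    (le_refl _) (le_refl _) (le_refl _)
  beta_reduce at hcore
  -- cost transfers: `log Y ≤ Λ_k + |D|(log n + 2)` for the three labellings
  have hc1 : ∀ a : ℕ, 1 ≤ a → (fun a : ℕ => Real.log a - 1 + (1 + Real.log a) / a) a ≤ Real.log a :=
    fun a ha => cost_le_log_nat ha
  have hc2 : ∀ a b : ℕ, 1 ≤ b → b ≤ a →
      (fun a : ℕ => Real.log a - 1 + (1 + Real.log a) / a) a -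
        (fun a : ℕ => Real.log a - 1 + (1 + Real.log a) / a) b ≤ 2 * (((a - b : ℕ) : ℝ) / b) :=
    fun a b hb hab => cost_sub_cost_le hb hab
  have hL1 : Real.log (Nat.card (youngSubgroup f₁)) ≤ (∑ x' : Fin P.card, (Real.log ((univ.filter fun y : Fin P.card => f₁ ((P.equivFin.symm y : P) : Fin n) = f₁ ((P.equivFin.symm x' : P) : Fin n)).card : ℕ) - 1 + (1 + Real.log ((univ.filter fun y : Fin P.card => f₁ ((P.equivFin.symm y : P) : Fin n) = f₁ ((P.equivFin.symm x' : P) : Fin n)).card : ℕ)) / ((univ.filter fun y : Fin P.card => f₁ ((P.equivFin.symm y : P) : Fin n) = f₁ ((P.equivFin.symm x' : P) : Fin n)).card : ℕ))) + (D.card : ℝ) * (Real.log n + 2) := by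
    have h1 := log_card_youngSubgroup_le_sum_cost f₁
    have h2 := sum_cost_le_restrict _ hc1 hc2 f₁ P
    beta_reduce at h2
    rw [hPc] at h2
    exact h1.trans h2
  have hL2 : Real.log (Nat.card (youngSubgroup f₂)) ≤ (∑ x' : Fin P.card, (Real.log ((univ.filter fun y : Fin P.card => f₂ ((P.equivFin.symm y : P) : Fin n) = f₂ ((P.equivFin.symm x' : P) : Fin n)).card : ℕ) - 1 + (1 + Real.log ((univ.filter fun y : Fin P.card => f₂ ((P.equivFin.symm y : P) : Fin n) = f₂ ((P.equivFin.symm x' : P) : Fin n)).card : ℕ)) / ((univ.filter fun y : Fin P.card => f₂ ((P.equivFin.symm y : P) : Fin n) = f₂ ((P.equivFin.symm x' : P) : Fin n)).card : ℕ))) + (D.card : ℝ) * (Real.log n + 2) := by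
    have h1 := log_card_youngSubgroup_le_sum_cost f₂
    have h2 := sum_cost_le_restrict _ hc1 hc2 f₂ P
    beta_reduce at h2
    rw [hPc] at h2
    exact h1.trans h2
  have hL3 : Real.log (Nat.card (youngSubgroup f₃)) ≤ (∑ x' : Fin P.card, (Real.log ((univ.filter fun y : Fin P.card => f₃ ((P.equivFin.symm y : P) : Fin n) = f₃ ((P.equivFin.symm x' : P) : Fin n)).card : ℕ) - 1 + (1 + Real.log ((univ.filter fun y : Fin P.card => f₃ ((P.equivFin.symm y : P) : Fin n) = f₃ ((P.equivFin.symm x' : P) : Fin n)).card : ℕ)) / ((univ.filter fun y : Fin P.card => f₃ ((P.equivFin.symm y : P) : Fin n) = f₃ ((P.equivFin.symm x' : P) : Fin n)).card : ℕ))) + (D.card : ℝ) * (Real.log n + 2) := by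
    have h1 := log_card_youngSubgroup_le_sum_cost f₃
    have h2 := sum_cost_le_restrict _ hc1 hc2 f₃ P
    beta_reduce at h2
    rw [hPc] at h2
    exact h1.trans h2
  -- bookkeeping
  have hsum : (∑ x' : Fin P.card, (Real.log ((univ.filter fun y : Fin P.card => f₁ ((P.equivFin.symm y : P) : Fin n) = f₁ ((P.equivFin.symm x' : P) : Fin n)).card : ℕ) - 1 + (1 + Real.log ((univ.filter fun y : Fin P.card => f₁ ((P.equivFin.symm y : P) : Fin n) = f₁ ((P.equivFin.symm x' : P) : Fin n)).card : ℕ)) / ((univ.filter fun y : Fin P.card => f₁ ((P.equivFin.symm y : P) : Fin n) = f₁ ((P.equivFin.symm x' : P) : Fin n)).card : ℕ))) + (∑ x' : Fin P.card, (Real.log ((univ.filter fun y : Fin P.card => f₂ ((P.equivFin.symm y : P) : Fin n) = f₂ ((P.equivFin.symm x' : P) : Fin n)).card : ℕ) - 1 + (1 + Real.log ((univ.filter fun y : Fin P.card => f₂ ((P.equivFin.symm y : P) : Fin n) = f₂ ((P.equivFin.symm x' : P) : Fin n)).card : ℕ)) / ((univ.filter fun y : Fin P.card => f₂ ((P.equivFin.symm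 y : P) : Fin n) = f₂ ((P.equivFin.symm x' : P) : Fin n)).card : ℕ))) + (∑ x' : Fin P.card, (Real.log ((univ.filter fun y : Fin P.card => f₃ ((P.equivFin.symm y : P) : Fin n) = f₃ ((P.equivFin.symm x' : P) : Fin n)).card : ℕ) - 1 + (1 + Real.log ((univ.filter fun y : Fin P.card => f₃ ((P.equivFin.symm y : P) : Fin n) = f₃ ((P.equivFin.symm x' : P) : Fin n)).card : ℕ)) / ((univ.filter fun y : Fin P.card => f₃ ((P.equivFin.symm y : P) : Fin n) = f₃ ((P.equivFin.symm x' : P) : Fin n)).card : ℕ))) ≤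
      3 / 2 * (P.card : ℕ) * Real.log (P.card : ℕ) - 9 / 5 * (P.card : ℕ) := hcore
  have hmono : 3 / 2 * ((P.card : ℕ) : ℝ) * Real.log (P.card : ℕ) ≤ 3 / 2 * ((P.card : ℕ) : ℝ) * Real.log n :=
    mul_le_mul_of_nonneg_left hlogn' (by positivity)
  set L : ℝ := (Real.log (Nat.card (youngSubgroup f₁)) + Real.log (Nat.card (youngSubgroup f₂)) +
      Real.log (Nat.card (youngSubgroup f₃))) / 3 with hL
  have h3 : 3 * L ≤ 3 / 2 * ((n : ℝ) - D.card) * Real.log n - 9 / 5 * ((n : ℝ) - D.card) +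
      3 * ((D.card : ℝ) * (Real.log n + 2)) := by
    rw [← hcardP, hL]
    linarith
  have := real_core hlogn (Nat.cast_nonneg _) hδ h3
  rw [hL] at this
  linarith


/-! ### The robust Young barrier -/

/-- **No threshold triple is a sub-exponential thinning of three Young cosets.**  For every `c` there is `n₀` such
that for `n ≥ n₀`: `S_i ⊆ Y_i·a_i` (`Y_i = youngSubgroup f_i`), `TPP(S₁, S₂, S₃)` and `|Y_i| ≤ e^{n/(400 log n)}·|S_i|`
(`i = 1,2,3`) imply `|S₁||S₂||S₃| ≤ (n!)^{3/2}·e^{-c√n}`. -/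
theorem thinnedYoungTriple_volume_le (c : ℝ) : ∃ n₀ : ℕ, ∀ n ≥ n₀, ∀ (f₁ f₂ f₃ : Fin n → ℕ)
    (a₁ a₂ a₃ : Equiv.Perm (Fin n)) (S₁ S₂ S₃ : Finset (Equiv.Perm (Fin n))),
    (∀ s ∈ S₁, s * a₁⁻¹ ∈ youngSubgroup f₁) → (∀ s ∈ S₂, s * a₂⁻¹ ∈ youngSubgroup f₂) →
    (∀ s ∈ S₃, s * a₃⁻¹ ∈ youngSubgroup f₃) → TripleProductProperty S₁ S₂ S₃ →
    (Nat.card (youngSubgroup f₁) : ℝ) ≤ Real.exp (n / (400 * Real.log n)) * S₁.card →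
    (Nat.card (youngSubgroup f₂) : ℝ) ≤ Real.exp (n / (400 * Real.log n)) * S₂.card →
    (Nat.card (youngSubgroup f₃) : ℝ) ≤ Real.exp (n / (400 * Real.log n)) * S₃.card →
    ((S₁.card * S₂.card * S₃.card : ℕ) : ℝ) ≤
      (n.factorial : ℝ) ^ ((3 : ℝ) / 2) * Real.exp (-(c * Real.sqrt (n : ℝ))) := by
  classical
  refine ⟨⌈2 * Real.exp 14⌉₊ + ⌈(5 * c) ^ 2⌉₊, fun n hn f₁ f₂ f₃ a₁ a₂ a₃ S₁ S₂ S₃ h₁ h₂ h₃ hT hθ₁ hθ₂ hθ₃ => ?_⟩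
  have hn_real : ((⌈2 * Real.exp 14⌉₊ + ⌈(5 * c) ^ 2⌉₊ : ℕ) : ℝ) ≤ n := by exact_mod_cast hn
  push_cast at hn_real
  have hn1 : 2 * Real.exp 14 ≤ (n : ℝ) :=
    le_trans (Nat.le_ceil _) (by linarith [Nat.cast_nonneg (α := ℝ) ⌈(5 * c) ^ 2⌉₊])
  have hn2 : (5 * c) ^ 2 ≤ (n : ℝ) :=
    le_trans (Nat.le_ceil _) (by linarith [Nat.cast_nonneg (α := ℝ) ⌈2 * Real.exp 14⌉₊])
  have he14 : 0 < Real.exp 14 := Real.exp_pos 14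
  have hnpos : (0 : ℝ) < n := by linarith
  have hlogn : 14 ≤ Real.log n := by
    have hlog_half : 14 ≤ Real.log ((n : ℝ) / 2) := by
      rw [Real.le_log_iff_exp_le (by linarith)]
      linarith
    exact hlog_half.trans (Real.log_le_log (by linarith) (by linarith))
  have hlogn_pos : 0 < Real.log n := by linarith
  have hRHS : (0 : ℝ) < (n.factorial : ℝ) ^ ((3 : ℝ) / 2) * Real.exp (-(c * Real.sqrt (n : ℝ))) := by
    have : (0 : ℝ) < (n.factorial : ℝ) := by exact_mod_cast Nat.factorial_pos n
    positivity
  -- empty sets are trivial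
  rcases Nat.eq_zero_or_pos S₁.card with h0 | hS₁
  · rw [h0]; simp only [zero_mul, Nat.cast_zero]; exact hRHS.le
  rcases Nat.eq_zero_or_pos S₂.card with h0 | hS₂
  · rw [h0]; simp only [mul_zero, zero_mul, Nat.cast_zero]; exact hRHS.le
  rcases Nat.eq_zero_or_pos S₃.card with h0 | hS₃
  · rw [h0]; simp only [mul_zero, Nat.cast_zero]; exact hRHS.le
  obtain ⟨u₀, hu₀⟩ := Finset.card_pos.1 hS₃
  obtain ⟨t₀, ht₀⟩ := Finset.card_pos.1 hS₂
  obtain ⟨s₀, hs₀⟩ := Finset.card_pos.1 hS₁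
  -- the three two-set conditions
  have p12 : ∀ s ∈ S₁, ∀ s' ∈ S₁, ∀ t ∈ S₂, ∀ t' ∈ S₂, s * s'⁻¹ * (t * t'⁻¹) = 1 → s = s' ∧ t = t' := by
    intro s hs s' hs' t ht t' ht' h
    have key := hT s hs s' hs' t ht t' ht' u₀ hu₀ u₀ hu₀ (by rw [mul_inv_cancel, mul_one]; exact h)
    exact ⟨key.1, key.2.1⟩
  have p13 : ∀ s ∈ S₁, ∀ s' ∈ S₁, ∀ u ∈ S₃, ∀ u' ∈ S₃, s * s'⁻¹ * (u * u'⁻¹) = 1 → s = s' ∧ u = u' := by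
    intro s hs s' hs' u hu u' hu' h
    have key := hT s hs s' hs' t₀ ht₀ t₀ ht₀ u hu u' hu' (by rw [mul_inv_cancel, mul_one]; exact h)
    exact ⟨key.1, key.2.2⟩
  have p23 : ∀ t ∈ S₂, ∀ t' ∈ S₂, ∀ u ∈ S₃, ∀ u' ∈ S₃, t * t'⁻¹ * (u * u'⁻¹) = 1 → t = t' ∧ u = u' := by
    intro t ht t' ht' u hu u' hu' h
    have key := hT s₀ hs₀ s₀ hs₀ t ht t' ht' u hu u' hu' (by rw [mul_inv_cancel, one_mul]; exact h)
    exact ⟨key.2.1, key.2.2⟩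
  set t : ℝ := (n : ℝ) / (400 * Real.log n) with ht_def
  have ht0 : 0 ≤ t := by positivity
  -- meets are at most `e^{2t}`
  have hmeet : ∀ (fa fb : Fin n → ℕ) (a b : Equiv.Perm (Fin n)) (S T : Finset (Equiv.Perm (Fin n))),
      0 < S.card → 0 < T.card →
      (∀ s ∈ S, s * a⁻¹ ∈ youngSubgroup fa) → (∀ t ∈ T, t * b⁻¹ ∈ youngSubgroup fb) →
      (∀ s ∈ S, ∀ s' ∈ S, ∀ t ∈ T, ∀ t' ∈ T, s * s'⁻¹ * (t * t'⁻¹) = 1 → s = s' ∧ t = t') →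
      (Nat.card (youngSubgroup fa) : ℝ) ≤ Real.exp t * S.card →
      (Nat.card (youngSubgroup fb) : ℝ) ≤ Real.exp t * T.card →
      Real.log (Nat.card (youngSubgroup (fun x => (fa x, fb x)))) ≤ 2 * t := by
    intro fa fb a b S T hSp hTp hS hT' hpair hθa hθb
    have hM := mul_mul_meet_le fa fb a b S T hS hT' hpair
    set M := Nat.card (youngSubgroup (fun x => (fa x, fb x))) with hM_def
    have hMpos : 0 < M := Nat.card_pos
    have hSR : (0 : ℝ) < S.card := by exact_mod_cast hSp
    have hTR : (0 : ℝ) < T.card := by exact_mod_cast hTp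
    have hMR : (S.card : ℝ) * T.card * (M : ℝ) ≤
        ((Nat.card (youngSubgroup fa) : ℕ) : ℝ) * ((Nat.card (youngSubgroup fb) : ℕ) : ℝ) := by
      exact_mod_cast hM
    have hY : ((Nat.card (youngSubgroup fa) : ℕ) : ℝ) * ((Nat.card (youngSubgroup fb) : ℕ) : ℝ) ≤
        (Real.exp t * S.card) * (Real.exp t * T.card) :=
      mul_le_mul hθa hθb (Nat.cast_nonneg _) (mul_nonneg (Real.exp_pos t).le (Nat.cast_nonneg _))
    have hM' : (M : ℝ) ≤ Real.exp t ^ 2 := by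
      have h1 : (S.card : ℝ) * T.card * (M : ℝ) ≤ (S.card : ℝ) * T.card * Real.exp t ^ 2 := by
        calc _ ≤ (Real.exp t * S.card) * (Real.exp t * T.card) := hMR.trans hY
          _ = (S.card : ℝ) * T.card * Real.exp t ^ 2 := by ring
      exact le_of_mul_le_mul_left h1 (mul_pos hSR hTR)
    calc Real.log M ≤ Real.log (Real.exp t ^ 2) := Real.log_le_log (by exact_mod_cast hMpos) hM'
      _ = 2 * t := by rw [Real.log_pow, Real.log_exp]; ring
  have h12 := hmeet f₁ f₂ a₁ a₂ S₁ S₂ hS₁ hS₂ h₁ h₂ p12 hθ₁ hθ₂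
  have h13 := hmeet f₁ f₃ a₁ a₃ S₁ S₃ hS₁ hS₃ h₁ h₃ p13 hθ₁ hθ₃
  have h23 := hmeet f₂ f₃ a₂ a₃ S₂ S₃ hS₂ hS₃ h₂ h₃ p23 hθ₂ hθ₃
  have hsum := sum_log_card_le_of_meets hn1 f₁ f₂ f₃ h12 h13 h23
  -- `|S_i| ≤ |Y_i|`
  have c₁ := card_le_card_young f₁ a₁ S₁ h₁
  have c₂ := card_le_card_young f₂ a₂ S₂ h₂
  have c₃ := card_le_card_young f₃ a₃ S₃ h₃
  have hS₁R : (0 : ℝ) < S₁.card := by exact_mod_cast hS₁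
  have hS₂R : (0 : ℝ) < S₂.card := by exact_mod_cast hS₂
  have hS₃R : (0 : ℝ) < S₃.card := by exact_mod_cast hS₃
  have l₁ : Real.log S₁.card ≤ Real.log (Nat.card (youngSubgroup f₁)) :=
    Real.log_le_log hS₁R (by exact_mod_cast c₁)
  have l₂ : Real.log S₂.card ≤ Real.log (Nat.card (youngSubgroup f₂)) :=
    Real.log_le_log hS₂R (by exact_mod_cast c₂)
  have l₃ : Real.log S₃.card ≤ Real.log (Nat.card (youngSubgroup f₃)) :=
    Real.log_le_log hS₃R (by exact_mod_cast c₃)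
  have hfact := sub_le_log_factorial n
  -- compare logarithms
  have hvol : (0 : ℝ) < ((S₁.card * S₂.card * S₃.card : ℕ) : ℝ) := by
    push_cast
    exact mul_pos (mul_pos hS₁R hS₂R) hS₃R
  rw [← Real.log_le_log_iff hvol hRHS]
  have hlhs : Real.log ((S₁.card * S₂.card * S₃.card : ℕ) : ℝ) =
      Real.log S₁.card + Real.log S₂.card + Real.log S₃.card := by
    push_cast
    rw [Real.log_mul (mul_pos hS₁R hS₂R).ne' hS₃R.ne', Real.log_mul hS₁R.ne' hS₂R.ne']
  have hrhs : Real.log ((n.factorial : ℝ) ^ ((3 : ℝ) / 2) * Real.exp (-(c * Real.sqrt (n : ℝ)))) =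
      3 / 2 * Real.log (n.factorial : ℝ) - c * Real.sqrt n := by
    rw [Real.log_mul (by positivity) (Real.exp_pos _).ne', Real.log_exp,
      Real.log_rpow (by exact_mod_cast Nat.factorial_pos n)]
    ring
  rw [hlhs, hrhs]
  -- `0.21 n ≥ c √n`
  have hsq : 0 ≤ Real.sqrt (n : ℝ) := Real.sqrt_nonneg _
  have hcs : c * Real.sqrt n ≤ 21 / 100 * n := by
    rcases le_or_gt c 0 with hc | hc
    · have : c * Real.sqrt n ≤ 0 := mul_nonpos_of_nonpos_of_nonneg hc hsq
      linarith
    · have h5 : 5 * c ≤ Real.sqrt n := by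
        calc 5 * c = Real.sqrt ((5 * c) ^ 2) := (Real.sqrt_sq (by positivity)).symm
          _ ≤ Real.sqrt n := Real.sqrt_le_sqrt hn2
      have hsqn : Real.sqrt (n : ℝ) * Real.sqrt n = n := Real.mul_self_sqrt (by positivity)
      have hc' : c ≤ Real.sqrt n / 5 := by linarith
      calc c * Real.sqrt n ≤ Real.sqrt n / 5 * Real.sqrt n := mul_le_mul_of_nonneg_right hc' hsq
        _ = n / 5 := by rw [div_mul_eq_mul_div, hsqn]
        _ ≤ 21 / 100 * n := by linarith
  linarith

/-- **The thinned-Young design family is empty** (`∀ c` form): `X` restricted to triples each of which lies in a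
right coset of a Young subgroup at most `e^{n/(400 log n)}` times its size is FALSE — the robust form of the Young
barrier for this crux (`θ_i = 1` is `Negative.not_thresholdYoungTriples`). -/
theorem not_thresholdThinnedYoungTriples :
    ¬ (∀ c : ℝ, 0 < c → ∀ n₀ : ℕ, ∃ n ≥ n₀, ∃ f₁ f₂ f₃ : Fin n → ℕ, ∃ a₁ a₂ a₃ : Equiv.Perm (Fin n),
        ∃ S₁ S₂ S₃ : Finset (Equiv.Perm (Fin n)),
          (∀ s ∈ S₁, s * a₁⁻¹ ∈ youngSubgroup f₁) ∧ (∀ s ∈ S₂, s * a₂⁻¹ ∈ youngSubgroup f₂) ∧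
          (∀ s ∈ S₃, s * a₃⁻¹ ∈ youngSubgroup f₃) ∧ TripleProductProperty S₁ S₂ S₃ ∧
          (Nat.card (youngSubgroup f₁) : ℝ) ≤ Real.exp (n / (400 * Real.log n)) * S₁.card ∧
          (Nat.card (youngSubgroup f₂) : ℝ) ≤ Real.exp (n / (400 * Real.log n)) * S₂.card ∧
          (Nat.card (youngSubgroup f₃) : ℝ) ≤ Real.exp (n / (400 * Real.log n)) * S₃.card ∧
          (n.factorial : ℝ) ^ ((3 : ℝ) / 2) * Real.exp (-(c * Real.sqrt (n : ℝ))) <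
            ((S₁.card * S₂.card * S₃.card : ℕ) : ℝ)) := by
  intro h
  obtain ⟨n₀, hn₀⟩ := thinnedYoungTriple_volume_le 1
  obtain ⟨n, hn, f₁, f₂, f₃, a₁, a₂, a₃, S₁, S₂, S₃, h₁, h₂, h₃, hT, hθ₁, hθ₂, hθ₃, hbig⟩ := h 1 one_pos n₀
  exact absurd hbig (not_lt.2 (hn₀ n hn f₁ f₂ f₃ a₁ a₂ a₃ S₁ S₂ S₃ h₁ h₂ h₃ hT hθ₁ hθ₂ hθ₃))

end Summit.MatrixMultiplication.MatrixMultiplication.Theorems.ThresholdSubsetTriples.Negative
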